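import Literature.NumberTheory.EllipticCurves.Sprung2012.ColemanMaps
import Literature.NumberTheory.EllipticCurves.PAdicBSD
import HarnessLib

/-!
# Sprung 2012, Theorem 2.2 (Honda systems exist) and Propositions 3.9 / 5.3 / 5.7 / Def. 5.9 (every
# class has exactly one ♯/♭ Coleman value) — named facts over the vocabulary of `ColemanMaps.lean`

Topic `Literature/NumberTheory/EllipticCurves`, cluster `Sprung2012` (namespace = path). THREE
published statements of F. E. I. Sprung, J. Number Theory **132** (2012) 1483–1506 [Sprung2012]
(held text `paper:doi-10-1016-j-jnt-2011-11-003`) vendored as NAMED FACTS (`def … : Prop`, nothing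
asserted; D-0014 — the first of them, Thm. 2.2, is now PROVED in the tree, see its docstring), in the
`η = 1` / `ℤ_p`-tower form and under the transcription
convention of `Sprung2012/ColemanMaps.lean` (module docstring there: at a supersingular prime
`H¹_Iw(T) ≅ Hom_ℤ(E(K_∞·K_v), ℤ_p)` by Tate local duality and Lemma 7.10, `(x, z)_n = z(x)`):

* `thm22_exists_isHondaSystem` — **Theorem 2.2** (p. 1487): "There exist `c_n ∈ F_ss(𝔪_n) ≅ Ê(𝔪_n)`
  so that as a `ℤ_p[G_n]`-module, `F_ss(𝔪_n)` is generated by `c_n` and `c_{n−1}` when `n ⩾ 0`.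
  `F_ss(𝔪_{−1})` is generated by `c_{−1}` when `p` is odd … (1) `Tr_{n+1/n} c_{n+1} = a_p c_n − c_{n−1}`
  if `n ⩾ 0`, (2) `Tr_{0/−1} c_0 = (a_p − 2)c_{−1}` when `p` is odd" — read on the `ℤ_p`-tower of
  `ℚ_p` ("See also … [Po1, Theorem 3.1] for the cyclotomic `ℤ_p`-extension of `ℚ_p` with odd `p`")
  as the predicate `Sprung2012.IsHondaSystem` (its docstring records the `Δ`-trace dictionary and the
  dual form of the generation clause);
* `prop39_exists_isColemanPair` — **Propositions 3.3/3.9, 5.3, 5.5, Corollary 5.6, Definition 5.9**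
  (pp. 1489–1495): every `z ∈ H¹_Iw(T)` has a Coleman value `Col(z) = (Col^♯(z), Col^♭(z)) ∈ Λ ⊕ Λ`
  ("`Coln(z) = (f♯(z), f♭(z)) ∈ (Λ_n ⊕ Λ_n)/Ker h_n`", "Let the Coleman map `Col : H¹_Iw(T) → Λ ⊕ Λ`
  be the projective limit of `Col_n`"), i.e. some `(L♯, L♭)` with `Sprung2012.IsColemanPair … z L♯ L♭`
  — for every functional `z` on `E(K_∞·K_v)` (at a supersingular prime every functional is a class,
  by the convention);
* `prop57_isColemanPair_unique` — **Proposition 5.7** (Limit Proposition, p. 1494: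
  "`lim←_n (Λ_n ⊕ Λ_n)/Ker h_n ≅ Λ ⊕ Λ`", proved via `⋂_n M_n = 0`): the Coleman value is unique.

Setting of all three (the paper's §2 standing hypotheses, p. 1486, and §7's odd `p`): `E = W/ℚ`
elliptic, `p ≠ 2` a prime of good SUPERSINGULAR reduction (`W.HasGoodReductionAtPrime p`,
`p ∣ a_p`), `κ` the cyclotomic `ℤ_p`-extension with normalised topological generator `γ`
(`κ.IsCyclotomic`, `κ.IsTopGenerator γ`, `IsCyclotomicVariable p γ` — "fix a topological generator
`γ` of `Γ`. By sending `γ` to `(1 + X)` …", p. 1486), `v` the place of `ℚ` above `p` with completion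
`ℚ_p = v.adicCompletion ℚ` and the chosen embedding `closureEmb`, and `g ∈ Γ_{ℚ_p}` a local element
restricting to the class of `γ` (`κ.IsTopGenerator (resGalOfEmb _ g)`; `p` is totally ramified in
`ℚ_∞`, so `G_∞` is at once the global and the local Galois group in the source). HONEST FRAMING (cell
`bsd-ssimc`, seat `bsd-ssimc-k3c5-kdot-split`, crux stmt-BirchSwinnertonDyer-19003): three named
facts, net debt +3 at typing (Thm. 2.2 since discharged, 2026-08-28: +2); nothing about any curve is
asserted; the identification of functionals with classes (Tate duality + Lemma 7.10) is part of what
the facts transcribe. TODO(general form): the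
full tower `k_n = ℚ_p(ζ_{p^{n+1}})` with `Λ = ℤ_p[Δ]⟦X⟧` and all tame characters `η`; `p = 2`.

## References
* [Sprung2012] Thm. 2.2 (p. 1487); Def. 3.1, Prop. 3.3, Lemma 3.5–3.6, Notation 3.7, Def. 3.8,
  Prop. 3.9 (pp. 1489–1491); Def. 5.1, Obs. 5.2, Prop. 5.3, Lemma 5.4, Prop. 5.5, Cor. 5.6, Prop. 5.7,
  Lemma 5.8, Def. 5.9 (pp. 1493–1495); Def. 7.1 (p. 1500); Lemma 7.10 (p. 1503).
* [Kobayashi2003] Prop. 8.12, Lemma 8.9, Lemma 8.15 (the `a_p = 0` case and the trace compatibility).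
-/

noncomputable section

open scoped Classical NumberField

open NumberField IsDedekindDomain WeierstrassCurve Literature.NumberTheory.EllipticCurves
  Literature.NumberTheory.EllipticCurves.ZpExtension Literature.NumberTheory.EllipticCurves.Sprung2017

namespace Literature.NumberTheory.EllipticCurves.Sprung2012

/-- **Sprung 2012, Theorem 2.2** (existence of a Honda system of local points; `ℤ_p`-tower form,
odd `p`). Printed (p. 1487): "There exist `c_n ∈ F_ss(𝔪_n) ≅ Ê(𝔪_n)` so that as a `ℤ_p[G_n]`-module,
`F_ss(𝔪_n)` is generated by `c_n` and `c_{n−1}` when `n ⩾ 0`. `F_ss(𝔪_{−1})` is generated by `c_{−1}`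
when `p` is odd … They satisfy the relations: (1) `Tr_{n+1/n} c_{n+1} = a_p c_n − c_{n−1}` if `n ⩾ 0`,
(2) `Tr_{0/−1} c_0 = (a_p − 2)c_{−1}` when `p` is odd." Here: for `W/ℚ` elliptic, `p ≠ 2` of good
supersingular reduction, the cyclotomic setting `(κ, γ)` and a local lift `g` of `γ` at the place
`v ∣ p`, there are `cneg = c_{−1}` and `c = (c'_n)_n` with `IsHondaSystem κ (closureEmb _) W (a_p) g cneg c`
(levels, the traced relations, generation in dual form — see `IsHondaSystem`). Nothing is asserted by
this `def`; users take `(h : thm22_exists_isHondaSystem)`. PROVED in the tree (2026-08-28):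
`Summit.BirchSwinnertonDyer.BirchSwinnertonDyer.Theorems.thm22_exists_isHondaSystem_holds`
(`Summits/BirchSwinnertonDyer/BirchSwinnertonDyer/Theorems/PrintX8VSInputHondaSystem.lean`, on the
17-file `Theorems.SprungHonda` series `PrintX8VSInputHondaSystem*.lean`: Sprung's sequence `x_k` and the
logarithm of the Honda type `t² − a_p t + p` over the tree's formal-group law, the integral isomorphism
`F_ss ≅ Ê`, Kobayashi's Prop. 8.12 generation, the `Δ`-descent to the `ℤ_p`-tower) — so `h` can be
discharged by that name. TODO(general form): the tower `ℚ_p(ζ_{p^{n+1}})`; `p = 2`.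
[cite: Sprung2012, Thm. 2.2 (p. 1487); Cor. 2.10 (p. 1489); Lemmas 7.4–7.5 (p. 1500)] -/
def thm22_exists_isHondaSystem : Prop :=
  ∀ (W : WeierstrassCurve ℚ) [W.IsElliptic] [W.IsGloballyMinimal] (p : ℕ) [Fact p.Prime],
    p ≠ 2 → W.HasGoodReductionAtPrime p → (p : ℤ) ∣ W.frobeniusTrace p →
    ∀ (κ : ZpExtension ℚ p) (γ : Field.absoluteGaloisGroup ℚ),
      κ.IsCyclotomic → κ.IsTopGenerator γ → IsCyclotomicVariable p γ →
    ∀ (v : HeightOneSpectrum (𝓞 ℚ)), (p : 𝓞 ℚ) ∈ v.asIdeal →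
    ∀ (g : Field.absoluteGaloisGroup (v.adicCompletion ℚ)),
      κ.IsTopGenerator (resGalOfEmb (closureEmb (K := ℚ) (v.adicCompletion ℚ)) g) →
    ∃ (cneg : localPoints W (v.adicCompletion ℚ)) (c : ℕ → localPoints W (v.adicCompletion ℚ)),
      IsHondaSystem κ (closureEmb (K := ℚ) (v.adicCompletion ℚ)) W (W.frobeniusTrace p) g cneg c

/-- **Sprung 2012, Propositions 3.9 / 5.3 / 5.5, Corollary 5.6, Definition 5.9 — every class has a
Coleman value.** Printed: "For `z ∈ H¹(k_n, T)`, there are `(f♯(z), f♭(z)) ∈ Λ_n^{⊕2}` so that we have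
`(P¹_n(z), P⁰_n(z)) = (f♯(z), f♭(z)) 𝓗_n`" (Prop. 3.9, p. 1491); "There is a unique homomorphism
`Col_n` so that [the diagram] commutes … `Col_n(z) = (f♯(z), f♭(z)) ∈ (Λ_n ⊕ Λ_n)/Ker h_n`" (Prop. 5.3,
p. 1493); "The Coleman maps are compatible" (Cor. 5.6); "Let the Coleman map `Col : H¹_Iw(T) → Λ ⊕ Λ`
be the projective limit of `Col_n`" (Def. 5.9, p. 1495). Here, in the setting of
`thm22_exists_isHondaSystem` and for any Honda system `(cneg, c)`: every functional `z` on
`E(ℚ_∞·ℚ_p)` (= every `z ∈ H¹_Iw(T)^{η=1}` under the convention of `ColemanMaps.lean`, Lemma 7.10)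
admits `(L♯, L♭) ∈ Λ²` with `IsColemanPair κ (closureEmb _) W (a_p) g c z L♯ L♭`. Nothing is asserted;
no `_holds` is expected. [cite: Sprung2012, Prop. 3.9 (p. 1491), Prop. 5.3, Prop. 5.5, Cor. 5.6 and Def. 5.9 (pp. 1493–1495), Lemma 7.10 (p. 1503)] -/
def prop39_exists_isColemanPair : Prop :=
  ∀ (W : WeierstrassCurve ℚ) [W.IsElliptic] [W.IsGloballyMinimal] (p : ℕ) [Fact p.Prime],
    p ≠ 2 → W.HasGoodReductionAtPrime p → (p : ℤ) ∣ W.frobeniusTrace p →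
    ∀ (κ : ZpExtension ℚ p) (γ : Field.absoluteGaloisGroup ℚ),
      κ.IsCyclotomic → κ.IsTopGenerator γ → IsCyclotomicVariable p γ →
    ∀ (v : HeightOneSpectrum (𝓞 ℚ)), (p : 𝓞 ℚ) ∈ v.asIdeal →
    ∀ (g : Field.absoluteGaloisGroup (v.adicCompletion ℚ)),
      κ.IsTopGenerator (resGalOfEmb (closureEmb (K := ℚ) (v.adicCompletion ℚ)) g) →
    ∀ (cneg : localPoints W (v.adicCompletion ℚ)) (c : ℕ → localPoints W (v.adicCompletion ℚ)),
      IsHondaSystem κ (closureEmb (K := ℚ) (v.adicCompletion ℚ)) W (W.frobeniusTrace p) g cneg c →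
    ∀ z : localTowerPointsOfEmb κ (closureEmb (K := ℚ) (v.adicCompletion ℚ)) W →+ ℤ_[p],
      ∃ Lsharp Lflat : IwasawaAlgebra p,
        IsColemanPair κ (closureEmb (K := ℚ) (v.adicCompletion ℚ)) W (W.frobeniusTrace p) g c z
          Lsharp Lflat

/-- **Sprung 2012, Proposition 5.7 (Limit Proposition) — the Coleman value is unique.** Printed
(p. 1494): "`lim←_n (Λ_n ⊕ Λ_n)/Ker h_n ≅ Λ ⊕ Λ`" — i.e. `⋂_n M_n = 0` for
`M_n = Ker(Λ² → Λ_n² →^{h_n})` (proof, pp. 1494–1495: "`M_{2m+ν} = 0` inside `Λ_ν^{⊕2}/p^m`", Lemma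
5.8), so two pairs `(L♯, L♭)`, `(L♯', L♭')` satisfying the level-`n` congruences of `IsColemanPair` for
all `n` coincide. Here, in the setting of `thm22_exists_isHondaSystem`, for any Honda system and any
functional `z`: `IsColemanPair … z L♯ L♭ → IsColemanPair … z L♯' L♭' → L♯ = L♯' ∧ L♭ = L♭'`. (Pure
`Λ`-algebra given `p ∣ a_p`; stated as a fact, provable in the tree in the manner of
`Sprung2017.IsChromaticLimit.unique`.) Nothing is asserted; no `_holds` is expected.
[cite: Sprung2012, Prop. 5.7 and Lemma 5.8 (pp. 1494–1495)] -/
def prop57_isColemanPair_unique : Prop :=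
  ∀ (W : WeierstrassCurve ℚ) [W.IsElliptic] [W.IsGloballyMinimal] (p : ℕ) [Fact p.Prime],
    p ≠ 2 → W.HasGoodReductionAtPrime p → (p : ℤ) ∣ W.frobeniusTrace p →
    ∀ (κ : ZpExtension ℚ p) (γ : Field.absoluteGaloisGroup ℚ),
      κ.IsCyclotomic → κ.IsTopGenerator γ → IsCyclotomicVariable p γ →
    ∀ (v : HeightOneSpectrum (𝓞 ℚ)), (p : 𝓞 ℚ) ∈ v.asIdeal →
    ∀ (g : Field.absoluteGaloisGroup (v.adicCompletion ℚ)),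
      κ.IsTopGenerator (resGalOfEmb (closureEmb (K := ℚ) (v.adicCompletion ℚ)) g) →
    ∀ (cneg : localPoints W (v.adicCompletion ℚ)) (c : ℕ → localPoints W (v.adicCompletion ℚ)),
      IsHondaSystem κ (closureEmb (K := ℚ) (v.adicCompletion ℚ)) W (W.frobeniusTrace p) g cneg c →
    ∀ (z : localTowerPointsOfEmb κ (closureEmb (K := ℚ) (v.adicCompletion ℚ)) W →+ ℤ_[p])
      (Lsharp Lflat Lsharp' Lflat' : IwasawaAlgebra p),
      IsColemanPair κ (closureEmb (K := ℚ) (v.adicCompletion ℚ)) W (W.frobeniusTrace p) g c z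
          Lsharp Lflat →
      IsColemanPair κ (closureEmb (K := ℚ) (v.adicCompletion ℚ)) W (W.frobeniusTrace p) g c z
          Lsharp' Lflat' →
      Lsharp = Lsharp' ∧ Lflat = Lflat'

end Literature.NumberTheory.EllipticCurves.Sprung2012

end
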